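import Literature.MathematicalPhysics.QuantumFieldTheory.QCDTimeReflectionProofs
import Literature.MathematicalPhysics.QuantumLattice.GrassmannReflectionPositivity
import Literature.MathematicalPhysics.QuantumLattice.GrassmannGaussianSymmetry
import Literature.MathematicalPhysics.QuantumLattice.GrassmannIntegralProofs
import HarnessLib

/-!
# A `γ₀`-diagonal spin basis for the torus quark algebra and the rotated OS reflection

The site-reflection positivity proof for `r = 1` Wilson quarks (Montvay–Münster §4.2.3
(4.100)–(4.111)) splits the quark variables of the reflection slice `t = 0` into `ξ = P₊ψ₀`,
`ηᵀ = −ψ̄₀P₋` (joining the positive half) and `ξ⁺ = ψ̄₀P₊`, `η⁺` (joining the negative half),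
`P± = (1 ± γ₀)/2`.  In the tree's chiral γ-basis (`euclideanGamma 0 = σʸ ⊗ σˣ`) `γ₀` is not diagonal,
so these are not generators of `FermiAlg`.  This file performs, once and for all, the change of
generators that diagonalises `γ₀` — a block substitution `ψ̄ ↦ ψ̄W`, `ψ ↦ W̄ψ` in the sense of
`GrassmannGaussianSymmetry.blockSubst`, `W` the (unnormalised, `W W† = 2`) matrix of `γ₀`-eigenvectors
— and transports the torus reflection `Θ_T` (`QCDTimeReflectionProofs`) to the new generators, where it
becomes a SIGNED PERMUTATION of generators:

* `spinW`, `spinSign` (`= (1, 1, −1, −1)`), `spinW_mul_conjTranspose`, `conjTranspose_mul_spinW`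
  (`W W† = W† W = 2`), `spinW_mul_euclideanGamma_zero` (`W γ₀ = Λ W`, `Λ = diag spinSign`);
* `spinBlock M` — the matrix `1 ⊗ 1 ⊗ 1 ⊗ M` on the quark index (flavour, site, colour untouched),
  `spinBlock_mul`, `spinBlock_one`;
* `spinRot` / `spinUnrot` — the algebra automorphisms `R = Λ(blockSubst (W†/2) (Wᵀ/2))`,
  `R' = Λ(blockSubst W W̄)` with `R ∘ R' = R' ∘ R = id` (`spinRot_spinUnrot`, `spinUnrot_spinRot`),
  `spinUnrot_qbar`, `spinUnrot_q`;
* `fermiThetaRot = R' ∘ Θ_T ∘ R`, an antilinear reflection (`GrassmannAlgebra.Reflection`) with the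
  generator law `fermiThetaRot_q : Θ' ψ_{f,x,a,m} = λ_m ψ̄_{f,θx,a,m}`,
  `fermiThetaRot_qbar : Θ' ψ̄_{f,x,a,m} = λ_m ψ_{f,θx,a,m}`;
* `spinUnrot_torusTheta : R' (Θ_T b) = Θ' (R' b)`, and the transport of Berezin integrals
  `fermiIntegral_eq_det_mul_spinUnrot : ∫ y = det(R) · ∫ R' y`.

Everything is proved; no named fact.  The numerical normalisation (`W W† = 2`, not `1`) avoids square
roots; it rescales the transported Dirac form by `2` and the Jacobian by a constant that cancels in
every normalised expectation.

## Sources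

I. Montvay, G. Münster, *Quantum Fields on a Lattice* (CUP 1994), §4.2.3 (4.102) ("choosing a
diagonal representation of `γ₄`"), App. 8.1.2 (8.10); the change of Grassmann generators is
Berezin's linear substitution (F. A. Berezin, *The Method of Second Quantization* (1966), Ch. I §3) as
in `GrassmannGaussianSymmetry`.
-/

open Literature.Probability Literature.Probability.LatticeModels Literature.MathematicalPhysics.QuantumLattice
open scoped Matrix ComplexConjugate Kronecker

noncomputable section

namespace Literature.MathematicalPhysics.QuantumFieldTheory

/-! ### The eigenvector matrix of `γ₀` -/

/-- The (unnormalised) matrix whose rows are conjugate `γ₀`-eigenvectors: `(Wψ)_m = ⟨v_m, ψ⟩`,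
`γ₀ v_m = λ_m v_m`, `λ = (1, 1, −1, −1)`, `W W† = 2`. [cite: MontvayMunster1994, App. 8.1.2 (8.10)] -/
def spinW : Matrix (Fin 4) (Fin 4) ℂ :=
  !![1, 0, 0, -Complex.I; 0, 1, -Complex.I, 0; 1, 0, 0, Complex.I; 0, 1, Complex.I, 0]

/-- The eigenvalues of `γ₀` in the order of the rows of `spinW`: `(1, 1, −1, −1)`. [cite: MontvayMunster1994, App. 8.1.2 (8.10)] -/
def spinSign : Fin 4 → ℂ := ![1, 1, -1, -1]

/-- `W W† = 2`. [folklore] -/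
theorem spinW_mul_conjTranspose : spinW * spinWᴴ = (2 : ℂ) • (1 : Matrix (Fin 4) (Fin 4) ℂ) := by
  ext i j
  fin_cases i <;> fin_cases j <;>
    simp [spinW, Matrix.mul_apply, Fin.sum_univ_four, Matrix.conjTranspose_apply, Matrix.smul_apply] <;>
    ring

/-- `W† W = 2`. [folklore] -/
theorem conjTranspose_mul_spinW : spinWᴴ * spinW = (2 : ℂ) • (1 : Matrix (Fin 4) (Fin 4) ℂ) := by
  ext i j
  fin_cases i <;> fin_cases j <;>
    simp [spinW, Matrix.mul_apply, Fin.sum_univ_four, Matrix.conjTranspose_apply, Matrix.smul_apply] <;>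
    ring

/-- `W γ₀ = Λ W`: the rows of `W` are (conjugate) eigenvectors. [cite: MontvayMunster1994, App. 8.1.2 (8.10)] -/
theorem spinW_mul_euclideanGamma_zero : spinW * euclideanGamma 0 = Matrix.diagonal spinSign * spinW := by
  rw [euclideanGamma_zero]
  ext i j
  fin_cases i <;> fin_cases j <;>
    simp [spinW, spinSign, Matrix.mul_apply, Fin.sum_univ_four, Matrix.diagonal]

/-- Entrywise: `Σ_α W_{mα} (γ₀)_{αβ} = λ_m W_{mβ}`. [folklore] -/
theorem sum_spinW_mul_euclideanGamma_zero (m β : Fin 4) :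
    ∑ α, spinW m α * euclideanGamma 0 α β = spinSign m * spinW m β := by
  have h := congrFun (congrFun spinW_mul_euclideanGamma_zero m) β
  rwa [Matrix.mul_apply, Matrix.diagonal_mul] at h

/-- Entrywise: `Σ_α (γ₀)_{βα} conj W_{mα} = λ_m conj W_{mβ}` (`γ₀` Hermitian, `λ` real). [folklore] -/
theorem sum_euclideanGamma_zero_mul_star_spinW (m β : Fin 4) :
    ∑ α, euclideanGamma 0 β α * star (spinW m α) = spinSign m * star (spinW m β) := by
  have h := congrArg star (sum_spinW_mul_euclideanGamma_zero m β)
  rw [star_sum, star_mul'] at h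
  have hs : star (spinSign m) = spinSign m := by fin_cases m <;> simp [spinSign]
  have hγ : ∀ α β : Fin 4, star (euclideanGamma 0 α β) = euclideanGamma 0 β α := fun α β => by
    simpa [Matrix.conjTranspose_apply] using congrFun (congrFun (euclideanGamma_isHermitian 0) β) α
  rw [hs] at h
  rw [← h]
  refine Finset.sum_congr rfl fun α _ => ?_
  rw [star_mul', hγ, mul_comm]

/-- Entrywise `W W† = 2`: `Σ_α W_{mα} conj W_{m'α} = 2 δ_{mm'}`. [folklore] -/
theorem sum_spinW_mul_star_spinW (m m' : Fin 4) :
    ∑ α, spinW m α * star (spinW m' α) = if m = m' then 2 else 0 := by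
  have h := congrFun (congrFun spinW_mul_conjTranspose m) m'
  simpa [Matrix.mul_apply, Matrix.conjTranspose_apply, Matrix.smul_apply, Matrix.one_apply] using h

/-- Entrywise `W† W = 2`: `Σ_m conj W_{mα} W_{mβ} = 2 δ_{αβ}`. [folklore] -/
theorem sum_star_spinW_mul_spinW (α β : Fin 4) :
    ∑ m, star (spinW m α) * spinW m β = if α = β then 2 else 0 := by
  have h := congrFun (congrFun conjTranspose_mul_spinW α) β
  simpa [Matrix.mul_apply, Matrix.conjTranspose_apply, Matrix.smul_apply, Matrix.one_apply] using h

/-! ### Spin blocks on the quark index -/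

section Blocks

variable {Nf L : ℕ} [NeZero L]

/-- The matrix `1 ⊗ 1 ⊗ 1 ⊗ M` acting on the spin index of the quark variables (flavour, site and
colour untouched), on the enumerated index `FermiIdx`. [folklore] -/
def spinBlock (M : Matrix (Fin 4) (Fin 4) ℂ) : Matrix (FermiIdx Nf L) (FermiIdx Nf L) ℂ :=
  Matrix.reindex quarkEquiv quarkEquiv
    ((1 : Matrix (Fin Nf) (Fin Nf) ℂ) ⊗ₖ ((1 : Matrix (TorusSite 4 L) (TorusSite 4 L) ℂ) ⊗ₖ
      ((1 : Matrix (Fin 3) (Fin 3) ℂ) ⊗ₖ M)))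

/-- Entries of a spin block. [folklore] -/
theorem spinBlock_apply (M : Matrix (Fin 4) (Fin 4) ℂ) (v w : QuarkVar Nf L) :
    spinBlock M (quarkEquiv v) (quarkEquiv w) =
      if v.1 = w.1 ∧ v.2.1 = w.2.1 ∧ v.2.2.1 = w.2.2.1 then M v.2.2.2 w.2.2.2 else 0 := by
  obtain ⟨f, x, a, α⟩ := v
  obtain ⟨g, y, b, β⟩ := w
  simp only [spinBlock, Matrix.reindex_apply, Matrix.submatrix_apply, Equiv.symm_apply_apply,
    Matrix.kroneckerMap_apply, Matrix.one_apply]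
  by_cases hf : f = g <;> by_cases hx : x = y <;> by_cases ha : a = b <;> simp [hf, hx, ha]

/-- Spin blocks multiply blockwise. [folklore] -/
theorem spinBlock_mul (M N : Matrix (Fin 4) (Fin 4) ℂ) :
    spinBlock (Nf := Nf) (L := L) M * spinBlock N = spinBlock (M * N) := by
  simp only [spinBlock, Matrix.reindex_apply, Matrix.submatrix_mul_equiv, ← Matrix.mul_kronecker_mul,
    Matrix.mul_one]

/-- The unit spin block. [folklore] -/
theorem spinBlock_one : spinBlock (Nf := Nf) (L := L) 1 = 1 := by
  simp only [spinBlock, Matrix.one_kronecker_one, Matrix.reindex_apply, Matrix.submatrix_one_equiv]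

/-- Spin blocks are linear in the block: scalars. [folklore] -/
theorem spinBlock_smul (c : ℂ) (M : Matrix (Fin 4) (Fin 4) ℂ) :
    spinBlock (Nf := Nf) (L := L) (c • M) = c • spinBlock M := by
  simp only [spinBlock, Matrix.kronecker_smul, Matrix.reindex_apply, Matrix.submatrix_smul]
  rfl

/-- Transpose of a spin block. [folklore] -/
theorem spinBlock_transpose (M : Matrix (Fin 4) (Fin 4) ℂ) :
    (spinBlock (Nf := Nf) (L := L) M)ᵀ = spinBlock Mᵀ := by
  ext i j
  obtain ⟨v, rfl⟩ := quarkEquiv.surjective i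
  obtain ⟨w, rfl⟩ := quarkEquiv.surjective j
  rw [Matrix.transpose_apply, spinBlock_apply, spinBlock_apply, Matrix.transpose_apply]
  by_cases h : v.1 = w.1 ∧ v.2.1 = w.2.1 ∧ v.2.2.1 = w.2.2.1
  · rw [if_pos h, if_pos ⟨h.1.symm, h.2.1.symm, h.2.2.symm⟩]
  · rw [if_neg h, if_neg fun h' => h ⟨h'.1.symm, h'.2.1.symm, h'.2.2.symm⟩]

/-- A block sum against a spin block collapses to a sum over the four spins of the block. [folklore] -/
theorem sum_spinBlock_smul (M : Matrix (Fin 4) (Fin 4) ℂ)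
    (f : Fin Nf) (x : TorusSite 4 L) (a : Fin 3) (α : Fin 4) (g : FermiIdx Nf L → FermiAlg Nf L) :
    ∑ k, spinBlock M k (quarkEquiv (f, (x, a, α))) • g k =
      ∑ m : Fin 4, M m α • g (quarkEquiv (f, (x, a, m))) := by
  rw [← Equiv.sum_comp quarkEquiv]
  simp only [spinBlock_apply, Fintype.sum_prod_type, ite_smul, zero_smul]
  rw [Finset.sum_eq_single f (fun f' _ hf' => by simp [hf']) (fun h => absurd (Finset.mem_univ f) h),
    Finset.sum_eq_single x (fun x' _ hx' => by simp [hx']) (fun h => absurd (Finset.mem_univ x) h),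
    Finset.sum_eq_single a (fun a' _ ha' => by simp [ha']) (fun h => absurd (Finset.mem_univ a) h)]
  simp

end Blocks

/-! ### The spin rotation of the torus quark algebra -/

section Rot

variable {Nf L : ℕ} [NeZero L]

/-- `Θ_T` is antilinear. [folklore] -/
theorem torusTheta_smul' (c : ℂ) (a : FermiAlg Nf L) :
    torusTheta (c • a) = starRingEnd ℂ c • torusTheta a :=
  LinearMap.map_smulₛₗ _ c a

/-- The spin rotation `R : ψ̄ᵢ ↦ Σ (W†/2)_{ki} ψ̄ₖ`, `ψⱼ ↦ Σ (Wᵀ/2)_{lj} ψₗ` (inverse of `spinUnrot`). [folklore] -/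
def spinRot : FermiAlg Nf L →ₐ[ℂ] FermiAlg Nf L :=
  ExteriorAlgebra.map (blockSubst ℂ (spinBlock (Nf := Nf) (L := L) ((2 : ℂ)⁻¹ • spinWᴴ))
    (spinBlock ((2 : ℂ)⁻¹ • spinWᵀ)))

/-- The spin "un-rotation" `R' : ψ̄_{f,x,a,α} ↦ Σ_m W_{mα} ψ̄_{f,x,a,m}`, `ψ_{f,x,a,α} ↦ Σ_m conj W_{mα} ψ_{f,x,a,m}`:
in the new generators `χ = R'⁻¹ψ`-coordinates `γ₀` is diagonal.  It is the block substitution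
`blockSubst (1⊗W) (1⊗W̄)`. [cite: MontvayMunster1994, §4.2.3 (4.102)] -/
def spinUnrot : FermiAlg Nf L →ₐ[ℂ] FermiAlg Nf L :=
  ExteriorAlgebra.map (blockSubst ℂ (spinBlock (Nf := Nf) (L := L) spinW) (spinBlock (spinW.map star)))

/-- Composition of block substitutions (substitute, then substitute again). [folklore] -/
theorem blockSubst_comp_blockSubst {ι : Type*} [LinearOrder ι] [Fintype ι] (S T S' T' : Matrix ι ι ℂ) :
    blockSubst ℂ S T ∘ₗ blockSubst ℂ S' T' = blockSubst ℂ (S * S') (T * T') := by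
  classical
  refine (Pi.basisFun ℂ _).ext fun w => ?_
  rw [Pi.basisFun_apply, LinearMap.comp_apply]
  obtain ⟨y, rfl⟩ : ∃ y, toLex y = w := ⟨ofLex w, rfl⟩
  rcases y with i | j
  · rw [blockSubst_single_inl, map_sum, blockSubst_single_inl]
    simp only [map_smul, blockSubst_single_inl, Finset.smul_sum, smul_smul, Matrix.mul_apply,
      Finset.sum_smul]
    rw [Finset.sum_comm]
    exact Finset.sum_congr rfl fun k _ => Finset.sum_congr rfl fun l _ => by rw [mul_comm]
  · rw [blockSubst_single_inr, map_sum, blockSubst_single_inr]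
    simp only [map_smul, blockSubst_single_inr, Finset.smul_sum, smul_smul, Matrix.mul_apply,
      Finset.sum_smul]
    rw [Finset.sum_comm]
    exact Finset.sum_congr rfl fun k _ => Finset.sum_congr rfl fun l _ => by rw [mul_comm]

/-- The identity block substitution is the identity. [folklore] -/
theorem blockSubst_one_one {ι : Type*} [LinearOrder ι] [Fintype ι] :
    blockSubst ℂ (1 : Matrix ι ι ℂ) 1 = LinearMap.id := by
  classical
  refine (Pi.basisFun ℂ _).ext fun w => ?_
  rw [Pi.basisFun_apply, LinearMap.id_apply]
  obtain ⟨y, rfl⟩ : ∃ y, toLex y = w := ⟨ofLex w, rfl⟩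
  rcases y with i | j
  · rw [blockSubst_single_inl]
    simp [Matrix.one_apply, ite_smul]
  · rw [blockSubst_single_inr]
    simp [Matrix.one_apply, ite_smul]

/-- `(W†/2) W = 1` blockwise. [folklore] -/
theorem spinBlock_half_conjTranspose_mul :
    spinBlock (Nf := Nf) (L := L) ((2 : ℂ)⁻¹ • spinWᴴ) * spinBlock spinW = 1 := by
  rw [spinBlock_mul, Matrix.smul_mul, conjTranspose_mul_spinW, smul_smul, inv_mul_cancel₀ two_ne_zero,
    one_smul, spinBlock_one]

/-- `W (W†/2) = 1` blockwise. [folklore] -/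
theorem spinBlock_mul_half_conjTranspose :
    spinBlock (Nf := Nf) (L := L) spinW * spinBlock ((2 : ℂ)⁻¹ • spinWᴴ) = 1 := by
  rw [spinBlock_mul, Matrix.mul_smul, spinW_mul_conjTranspose, smul_smul, inv_mul_cancel₀ two_ne_zero,
    one_smul, spinBlock_one]

/-- `Wᵀ W̄ = 2`. [folklore] -/
theorem transpose_mul_map_star_spinW : spinWᵀ * spinW.map star = (2 : ℂ) • (1 : Matrix (Fin 4) (Fin 4) ℂ) := by
  ext i j
  fin_cases i <;> fin_cases j <;>
    simp [spinW, Matrix.mul_apply, Fin.sum_univ_four, Matrix.smul_apply] <;> ring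

/-- `W̄ Wᵀ = 2`. [folklore] -/
theorem map_star_spinW_mul_transpose : spinW.map star * spinWᵀ = (2 : ℂ) • (1 : Matrix (Fin 4) (Fin 4) ℂ) := by
  ext i j
  fin_cases i <;> fin_cases j <;>
    simp [spinW, Matrix.mul_apply, Fin.sum_univ_four, Matrix.smul_apply] <;> ring

/-- `(Wᵀ/2) W̄ = 1` blockwise. [folklore] -/
theorem spinBlock_half_transpose_mul :
    spinBlock (Nf := Nf) (L := L) ((2 : ℂ)⁻¹ • spinWᵀ) * spinBlock (spinW.map star) = 1 := by
  rw [spinBlock_mul, Matrix.smul_mul, transpose_mul_map_star_spinW, smul_smul, inv_mul_cancel₀ two_ne_zero,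
    one_smul, spinBlock_one]

/-- `W̄ (Wᵀ/2) = 1` blockwise. [folklore] -/
theorem spinBlock_mul_half_transpose :
    spinBlock (Nf := Nf) (L := L) (spinW.map star) * spinBlock ((2 : ℂ)⁻¹ • spinWᵀ) = 1 := by
  rw [spinBlock_mul, Matrix.mul_smul, map_star_spinW_mul_transpose, smul_smul, inv_mul_cancel₀ two_ne_zero,
    one_smul, spinBlock_one]

/-- `R ∘ R' = id`. [folklore] -/
theorem spinRot_spinUnrot (y : FermiAlg Nf L) : spinRot (spinUnrot y) = y := by
  rw [spinRot, spinUnrot, ← AlgHom.comp_apply, ExteriorAlgebra.map_comp_map, blockSubst_comp_blockSubst,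
    spinBlock_half_conjTranspose_mul, spinBlock_half_transpose_mul, blockSubst_one_one,
    ExteriorAlgebra.map_id, AlgHom.id_apply]

/-- `R' ∘ R = id`. [folklore] -/
theorem spinUnrot_spinRot (y : FermiAlg Nf L) : spinUnrot (spinRot y) = y := by
  rw [spinRot, spinUnrot, ← AlgHom.comp_apply, ExteriorAlgebra.map_comp_map, blockSubst_comp_blockSubst,
    spinBlock_mul_half_conjTranspose, spinBlock_mul_half_transpose, blockSubst_one_one,
    ExteriorAlgebra.map_id, AlgHom.id_apply]

/-- `R'` on `ψ̄`: `R' ψ̄_{f,x,a,α} = Σ_m W_{mα} ψ̄_{f,x,a,m}`. [folklore] -/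
theorem spinUnrot_qbar (f : Fin Nf) (x : TorusSite 4 L) (a : Fin 3) (α : Fin 4) :
    spinUnrot (qbar (f, (x, a, α))) = ∑ m : Fin 4, spinW m α • qbar (f, (x, a, m)) := by
  rw [spinUnrot, qbar, map_blockSubst_psiBar]
  exact sum_spinBlock_smul spinW f x a α (fun k => psiBar ℂ k)

/-- `R'` on `ψ`: `R' ψ_{f,x,a,α} = Σ_m conj W_{mα} ψ_{f,x,a,m}`. [folklore] -/
theorem spinUnrot_q (f : Fin Nf) (x : TorusSite 4 L) (a : Fin 3) (α : Fin 4) :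
    spinUnrot (q (f, (x, a, α))) = ∑ m : Fin 4, star (spinW m α) • q (f, (x, a, m)) := by
  rw [spinUnrot, q, map_blockSubst_psi]
  exact sum_spinBlock_smul (spinW.map star) f x a α (fun k => psi ℂ k)

/-- `R` on `ψ̄`: `R ψ̄_{f,x,a,m} = ½ Σ_α conj W_{mα} ψ̄_{f,x,a,α}`. [folklore] -/
theorem spinRot_qbar (f : Fin Nf) (x : TorusSite 4 L) (a : Fin 3) (m : Fin 4) :
    spinRot (qbar (f, (x, a, m))) = ∑ α : Fin 4, ((2 : ℂ)⁻¹ * star (spinW m α)) • qbar (f, (x, a, α)) := by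
  rw [spinRot, qbar, map_blockSubst_psiBar]
  rw [sum_spinBlock_smul ((2 : ℂ)⁻¹ • spinWᴴ) f x a m (fun k => psiBar ℂ k)]
  refine Finset.sum_congr rfl fun α _ => ?_
  rw [Matrix.smul_apply, Matrix.conjTranspose_apply, smul_eq_mul]
  rfl

/-- `R` on `ψ`: `R ψ_{f,x,a,m} = ½ Σ_α W_{mα} ψ_{f,x,a,α}`. [folklore] -/
theorem spinRot_q (f : Fin Nf) (x : TorusSite 4 L) (a : Fin 3) (m : Fin 4) :
    spinRot (q (f, (x, a, m))) = ∑ α : Fin 4, ((2 : ℂ)⁻¹ * spinW m α) • q (f, (x, a, α)) := by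
  rw [spinRot, q, map_blockSubst_psi]
  rw [sum_spinBlock_smul ((2 : ℂ)⁻¹ • spinWᵀ) f x a m (fun k => psi ℂ k)]
  refine Finset.sum_congr rfl fun α _ => ?_
  rw [Matrix.smul_apply, Matrix.transpose_apply, smul_eq_mul]
  rfl

/-! ### The rotated reflection -/

/-- **The OS reflection in the `γ₀`-diagonal generators**: `Θ' = R' ∘ Θ_T ∘ R`, a `conj`-semilinear
map. [cite: MontvayMunster1994, §4.2.3 (4.99) and (4.102)] -/
def fermiThetaRotLin : FermiAlg Nf L →ₗ⋆[ℂ] FermiAlg Nf L :=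
  ((spinUnrot (Nf := Nf) (L := L)).toLinearMap.comp torusTheta).comp
    (spinRot (Nf := Nf) (L := L)).toLinearMap

/-- `Θ' y = R' (Θ_T (R y))`. [folklore] -/
theorem fermiThetaRotLin_apply (y : FermiAlg Nf L) :
    fermiThetaRotLin y = spinUnrot (torusTheta (spinRot y)) := rfl

/-- **`Θ'` as an antilinear reflection** (`GrassmannAlgebra.Reflection`): unital, order reversing,
degree one to degree one. [cite: MontvayMunster1994, §4.2.3 (4.91)] -/
def fermiThetaRot : GrassmannAlgebra.Reflection (FermiIdx Nf L ⊕ₗ FermiIdx Nf L) where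
  toLinearMap := fermiThetaRotLin
  map_one' := by rw [fermiThetaRotLin_apply, map_one, torusTheta_one, map_one]
  map_mul' a b := by
    rw [fermiThetaRotLin_apply, fermiThetaRotLin_apply, fermiThetaRotLin_apply, map_mul, torusTheta_mul,
      map_mul]
  exists_map_ι' v := by
    refine ⟨blockSubst ℂ (spinBlock spinW) (spinBlock (spinW.map star))
      (torusThetaLin (star (blockSubst ℂ (spinBlock ((2 : ℂ)⁻¹ • spinWᴴ))
        (spinBlock ((2 : ℂ)⁻¹ • spinWᵀ)) v))), ?_⟩
    rw [fermiThetaRotLin_apply, spinRot, ExteriorAlgebra.map_apply_ι, torusTheta_ι, spinUnrot,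
      ExteriorAlgebra.map_apply_ι]

/-- Unfolding the packaged reflection. [folklore] -/
theorem fermiThetaRot_apply (y : FermiAlg Nf L) :
    fermiThetaRot y = spinUnrot (torusTheta (spinRot y)) := rfl

/-- **`R'` intertwines `Θ_T` and `Θ'`**: `R' (Θ_T b) = Θ' (R' b)`. [folklore] -/
theorem spinUnrot_torusTheta (b : FermiAlg Nf L) :
    spinUnrot (torusTheta b) = fermiThetaRot (spinUnrot b) := by
  rw [fermiThetaRot_apply, spinRot_spinUnrot]

/-- The spin sums behind the generator law on `ψ`:
`Σ_α conj(W_{mα}/2) (γ₀)_{βα} = λ_m conj W_{mβ} / 2`. [folklore] -/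
theorem sum_star_half_spinW_mul_gamma (m β : Fin 4) :
    ∑ α, starRingEnd ℂ ((2 : ℂ)⁻¹ * spinW m α) * euclideanGamma 0 β α =
      spinSign m * ((2 : ℂ)⁻¹ * star (spinW m β)) := by
  rw [show spinSign m * ((2 : ℂ)⁻¹ * star (spinW m β)) = (2 : ℂ)⁻¹ * (spinSign m * star (spinW m β)) by ring,
    ← sum_euclideanGamma_zero_mul_star_spinW, Finset.mul_sum]
  refine Finset.sum_congr rfl fun α _ => ?_
  rw [map_mul, map_inv₀, map_ofNat, starRingEnd_apply]
  ring

/-- The spin sums behind the generator law on `ψ̄`: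
`Σ_α conj(conj W_{mα}/2) (γ₀)_{αβ} = λ_m W_{mβ} / 2`. [folklore] -/
theorem sum_star_half_star_spinW_mul_gamma (m β : Fin 4) :
    ∑ α, starRingEnd ℂ ((2 : ℂ)⁻¹ * star (spinW m α)) * euclideanGamma 0 α β =
      spinSign m * ((2 : ℂ)⁻¹ * spinW m β) := by
  rw [show spinSign m * ((2 : ℂ)⁻¹ * spinW m β) = (2 : ℂ)⁻¹ * (spinSign m * spinW m β) by ring,
    ← sum_spinW_mul_euclideanGamma_zero, Finset.mul_sum]
  refine Finset.sum_congr rfl fun α _ => ?_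
  rw [map_mul, map_inv₀, map_ofNat, starRingEnd_apply, star_star]
  ring

/-- **The rotated reflection on `ψ`**: `Θ' ψ_{f,x,a,m} = λ_m ψ̄_{f,θx,a,m}` — a signed generator
permutation. [cite: MontvayMunster1994, §4.2.3 (4.99) and (4.102)] -/
theorem fermiThetaRot_q (f : Fin Nf) (x : TorusSite 4 L) (a : Fin 3) (m : Fin 4) :
    fermiThetaRot (q (f, (x, a, m))) = spinSign m • qbar (f, (Site.negReflect x, a, m)) := by
  have key : torusTheta (spinRot (q (f, (x, a, m)))) =
      spinRot (spinSign m • qbar (f, (Site.negReflect x, a, m))) := by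
    rw [spinRot_q, map_sum, map_smul, spinRot_qbar, Finset.smul_sum]
    simp only [torusTheta_smul', torusTheta_q, Finset.smul_sum, smul_smul]
    rw [Finset.sum_comm]
    refine Finset.sum_congr rfl fun β _ => ?_
    rw [← Finset.sum_smul, sum_star_half_spinW_mul_gamma]
  change spinUnrot (torusTheta (spinRot (q (f, (x, a, m))))) = _
  rw [key, spinUnrot_spinRot]

/-- **The rotated reflection on `ψ̄`**: `Θ' ψ̄_{f,x,a,m} = λ_m ψ_{f,θx,a,m}`. [cite: MontvayMunster1994, §4.2.3 (4.99) and (4.102)] -/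
theorem fermiThetaRot_qbar (f : Fin Nf) (x : TorusSite 4 L) (a : Fin 3) (m : Fin 4) :
    fermiThetaRot (qbar (f, (x, a, m))) = spinSign m • q (f, (Site.negReflect x, a, m)) := by
  have key : torusTheta (spinRot (qbar (f, (x, a, m)))) =
      spinRot (spinSign m • q (f, (Site.negReflect x, a, m))) := by
    rw [spinRot_qbar, map_sum, map_smul, spinRot_q, Finset.smul_sum]
    simp only [torusTheta_smul', torusTheta_qbar, Finset.smul_sum, smul_smul]
    rw [Finset.sum_comm]
    refine Finset.sum_congr rfl fun β _ => ?_
    rw [← Finset.sum_smul, sum_star_half_star_spinW_mul_gamma]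
  change spinUnrot (torusTheta (spinRot (qbar (f, (x, a, m))))) = _
  rw [key, spinUnrot_spinRot]

/-! ### Transport of Berezin integrals -/

/-- **Transport of the torus Berezin integral to the rotated generators**: for all `y`,
`∫dψ̄dψ y = det(R) · ∫dψ̄dψ (R' y)` (`R R' = id`; Berezin's Jacobian rule `berezin_map`). [folklore] -/
theorem fermiIntegral_eq_det_mul_spinUnrot (y : FermiAlg Nf L) :
    fermiIntegral y =
      LinearMap.det (blockSubst ℂ (spinBlock (Nf := Nf) (L := L) ((2 : ℂ)⁻¹ • spinWᴴ))
        (spinBlock ((2 : ℂ)⁻¹ • spinWᵀ))) * fermiIntegral (spinUnrot y) := by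
  conv_lhs => rw [← spinRot_spinUnrot y]
  rw [fermiIntegral, spinRot, GrassmannAlgebra.berezin_map]

/-- `R'` transports the fermionic Boltzmann factor to the rotated Dirac form
`D' = (1⊗W) D (1⊗W̄)ᵀ = (1⊗W) D (1⊗W†)`. [folklore] -/
theorem spinUnrot_grassmannExp_quadratic (A : Matrix (FermiIdx Nf L) (FermiIdx Nf L) ℂ) :
    spinUnrot (grassmannExp (quadratic ℂ A)) =
      grassmannExp (quadratic ℂ (spinBlock spinW * A * spinBlock spinWᴴ)) := by
  rw [spinUnrot, map_blockSubst_grassmannExp_quadratic, spinBlock_transpose]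
  rfl

end Rot

end Literature.MathematicalPhysics.QuantumFieldTheory

end
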